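import Summits.ValiantsHypothesis.ValiantsHypothesis.Theorems.TwoProducts.RankTwoJacobianOstrowski

/-!
# Rank-two Jacobian, part 3: the AXIAL TRANSFER (Lemma 2, the load-bearing step) and the dependent case — in the kernel

`OnAxis`, `IsAxialLead`, `IsSpecial`, the typed `AxialTransfer` / `DependentCase` and their proofs ★★ `axialTransfer : AxialTransfer`
(`F ≠ 0 → IsAxialLead ν w e → IsEdgeDir ν F → IsSpecial ν F e ∨ IsEdgeDir ν (jac F w)`: `J(F,w)` as an explicit double sum `idet`/`jac_eq_sum`/`coeff_jac`,
the top coefficient `coeff_jac_top`, `onAxis_unique`) and ★ `dependentCase : DependentCase` (`jac w₂ w₁ = 0 → IsAxialLead ν w₁ e → ¬ IsEdgeDir ν (P(w₁,w₂))`,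
via ✓ `chainRule`).

Lift (val-lit-p3 g18, desk #454/#455; critic of record val-idea-crit-8 g3, VERDICT #28 KERNEL ACK + CONTENT GO 03:21:12Z «GO from me on those
statements too») of the FURTHER kernel lemmas of val-idea-35 g9's crux workfile `Cruxes/TwoProducts/RankTwoJacobian_val_idea_35_g9.lean` rev @7f92ff69cb00
(sha16 86ff8e732f9c58b2, 638 l., farm rc 0 / 0 sorry per crit-8) — bodies VERBATIM, namespace `…Cruxes.TwoProducts.ValIdea35g9` →
`…Theorems.TwoProducts.RankTwoJacobian` (continues ✓ P1 `Theorems/TwoProducts/RankTwoJacobian.lean`: `Poly2`, `emb`, `nv`, `theta`, `jac`, `chainRule`, `jacSupportBound`).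
HONEST LABEL: helper lemmas for the SIDE ladder «table-rank-ladder» (K13 K1, VERDICT #26 (U1)) of crux `stmt-ValiantsHypothesis-5906` (`TwoProducts`);
the implication `PortPlan.1` (arc bookkeeping, tower induction, vertex count) and the rank-two composition law are NOT here; nothing closes 5906 /
`PlanarCellBound` / `ResidualLawV25`; VP ≠ VNP is NOT proved.  `--supports stmt-ValiantsHypothesis-5906 --as helper`.  Credit: val-idea-35 g9.
No instances, no notation, no named facts. [folklore]
-/

noncomputable section
set_option linter.dupNamespace false

namespace Summit.ValiantsHypothesis.ValiantsHypothesis.Theorems.TwoProducts.RankTwoJacobian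

open scoped BigOperators Pointwise
open MvPolynomial

/-- `det(p,e) = 0`: the exponent `p` lies on the line `ℝ·e` through the origin. -/
def OnAxis (p e : Fin 2 →₀ ℕ) : Prop := ((p 0 : ℕ) : ℤ) * ((e 1 : ℕ) : ℤ) = ((p 1 : ℕ) : ℤ) * ((e 0 : ℕ) : ℤ)

/-- AXIAL LEAD: `e ≠ 0` is the strict `ν`-top exponent of `w` among its NON-CONSTANT monomials and `⟨ν,e⟩ ≠ 0`.
(The constant term of `w` is irrelevant: `J(·,w)` kills it.)  For fixed `w` with `≤ t` monomials this holds, with a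
locally constant `e`, for all `ν` off `≤ 3t` exceptional directions (edge normals of `conv(supp w ∖ 0)` and the lines
`⟨ν,e⟩ = 0`) — memo Lemma 1. -/
def IsAxialLead (ν : Fin 2 → ℝ) (w : Poly2) (e : Fin 2 →₀ ℕ) : Prop :=
  e ∈ w.support ∧ e ≠ 0 ∧ wt ν e ≠ 0 ∧ ∀ s ∈ w.support, s ≠ 0 → s ≠ e → wt ν s < wt ν e

/-- `ν` is `e`-SPECIAL for `F`: the `ν`-top set of `supp F` is exactly two points, one of them on the axis `ℝ·e`.
On an arc where `e` is the axial lead, at most ONE vertex of the chain of `Newt F` facing the arc lies on `ℝ·e`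
(two such differ by `λe`, and `⟨ν,λe⟩` has constant sign on the arc), hence ≤ 2 special directions per arc — memo Lemma 2. -/
def IsSpecial (ν : Fin 2 → ℝ) (F : Poly2) (e : Fin 2 →₀ ℕ) : Prop :=
  ∃ p ∈ F.support, ∃ q ∈ F.support, p ≠ q ∧ (∀ r ∈ F.support, wt ν r ≤ wt ν p) ∧ wt ν q = wt ν p ∧
    (∀ r ∈ F.support, wt ν r = wt ν p → r = p ∨ r = q) ∧ (OnAxis p e ∨ OnAxis q e)

/-- LEMMA 2 (axial transfer; memo §1): if `e` is the axial lead of `w` at `ν` and `ν` is an edge direction of `F ≠ 0`,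
then `ν` is `e`-special for `F` or an edge direction of `J(F,w)`.  Proof: the top `ν`-component of `J(F,w)` is
`J(in_ν F, c X^e) = c Σ_γ F_γ det(γ,e) X^{γ+e}`, and the edge line `{⟨ν,·⟩ = M}` meets `ℝe` in ≤ 1 point. -/
def AxialTransfer : Prop :=
  ∀ (ν : Fin 2 → ℝ) (F w : Poly2) (e : Fin 2 →₀ ℕ),
    F ≠ 0 → IsAxialLead ν w e → IsEdgeDir ν F → IsSpecial ν F e ∨ IsEdgeDir ν (jac F w)

/-- DEPENDENT CASE (memo §2 (i)): if `J(w₂,w₁) = 0` then `Newt P(w₁,w₂)` has no edge direction at any `ν` where `w₁`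
has an axial lead (so `nv ≤ 3t + 1`). -/
def DependentCase : Prop :=
  ∀ (ν : Fin 2 → ℝ) (P w₁ w₂ : Poly2) (e : Fin 2 →₀ ℕ),
    jac w₂ w₁ = 0 → IsAxialLead ν w₁ e → ¬ IsEdgeDir ν (MvPolynomial.aeval ![w₁, w₂] P)

/-! ## Kernel: Lemma 2 (AXIAL TRANSFER — the load-bearing step), sorry-free
`J(F,w)` is an explicit double sum of monomials `F_γ w_s det(γ,s) X^{γ+s}`; above a top point `γ₀` of `F` the
coefficient of `X^{γ₀+e}` is `F_{γ₀} w_e det(γ₀,e)` (unique decomposition, the constant term of `w` being killed by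
`det(γ,0) = 0`), and two top points on the axis `ℝ·e` coincide because `⟨ν,e⟩ ≠ 0`. -/

/-- integer determinant of two exponents -/
def idet (γ s : Fin 2 →₀ ℕ) : ℤ := ((γ 0 : ℕ) : ℤ) * ((s 1 : ℕ) : ℤ) - ((γ 1 : ℕ) : ℤ) * ((s 0 : ℕ) : ℤ)

/-- `OnAxis p e ↔ idet p e = 0`. [folklore] -/
theorem onAxis_iff_idet (p e : Fin 2 →₀ ℕ) : OnAxis p e ↔ idet p e = 0 := by
  unfold OnAxis idet; constructor <;> intro h <;> linarith

/-- `idet γ 0 = 0` (constants are killed). [folklore] -/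
theorem idet_zero_right (γ : Fin 2 →₀ ℕ) : idet γ 0 = 0 := by simp [idet]

/-- `J(F,w)` as an explicit double sum of monomials. -/
theorem jac_eq_sum (F w : Poly2) :
    jac F w = ∑ γ ∈ F.support, ∑ s ∈ w.support,
      monomial (γ + s) (coeff γ F * coeff s w * ((idet γ s : ℤ) : ℂ)) := by
  unfold jac
  rw [theta_eq_sum 0 F, theta_eq_sum 1 w, theta_eq_sum 1 F, theta_eq_sum 0 w,
    Finset.sum_mul_sum, Finset.sum_mul_sum, ← Finset.sum_sub_distrib]
  refine Finset.sum_congr rfl fun γ _ => ?_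
  rw [← Finset.sum_sub_distrib]
  refine Finset.sum_congr rfl fun s _ => ?_
  rw [monomial_mul, monomial_mul, ← map_sub]
  congr 1
  simp only [idet, Int.cast_sub, Int.cast_mul, Int.cast_natCast]
  ring

/-- Coefficient formula for the toric Jacobian. [val-idea-35 g9] -/
theorem coeff_jac (F w : Poly2) (u : Fin 2 →₀ ℕ) :
    coeff u (jac F w) = ∑ x ∈ F.support ×ˢ w.support,
      (if x.1 + x.2 = u then coeff x.1 F * coeff x.2 w * ((idet x.1 x.2 : ℤ) : ℂ) else 0) := by
  rw [jac_eq_sum, coeff_sum, Finset.sum_product]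
  refine Finset.sum_congr rfl fun γ _ => ?_
  rw [coeff_sum]
  refine Finset.sum_congr rfl fun s _ => ?_
  rw [coeff_monomial]

/-- Every support point of `J(F,w)` is `γ + s` with `γ ∈ supp F`, `s ∈ supp w` and `det(γ,s) ≠ 0`. -/
theorem exists_of_mem_support_jac (F w : Poly2) (u : Fin 2 →₀ ℕ) (hu : u ∈ (jac F w).support) :
    ∃ γ ∈ F.support, ∃ s ∈ w.support, γ + s = u ∧ idet γ s ≠ 0 := by
  rw [MvPolynomial.mem_support_iff, coeff_jac] at hu
  obtain ⟨⟨γ, s⟩, hx, hne⟩ := Finset.exists_ne_zero_of_sum_ne_zero hu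
  obtain ⟨hγ, hs⟩ := Finset.mem_product.mp hx
  refine ⟨γ, hγ, s, hs, ?_, ?_⟩
  · by_contra h
    exact hne (if_neg h)
  · intro h
    apply hne
    simp [h]

/-- The TOP coefficient of `J(F,w)` above a top point `γ₀` of `F`, when `e` is the axial lead of `w`. -/
theorem coeff_jac_top (ν : Fin 2 → ℝ) (F w : Poly2) (e γ₀ : Fin 2 →₀ ℕ) (hlead : IsAxialLead ν w e)
    (hγ₀ : γ₀ ∈ F.support) (htop : ∀ r ∈ F.support, wt ν r ≤ wt ν γ₀) :
    coeff (γ₀ + e) (jac F w) = coeff γ₀ F * coeff e w * ((idet γ₀ e : ℤ) : ℂ) := by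
  obtain ⟨he, he0, hwe, hdom⟩ := hlead
  rw [coeff_jac]
  rw [Finset.sum_eq_single (γ₀, e)]
  · simp
  · rintro ⟨γ, s⟩ hx hne
    obtain ⟨hγ, hs⟩ := Finset.mem_product.mp hx
    dsimp only
    split_ifs with h
    · -- γ + s = γ₀ + e with (γ,s) ≠ (γ₀,e): only possible with s = 0
      by_cases hs0 : s = 0
      · subst hs0; simp [idet_zero_right]
      · exfalso
        by_cases hse : s = e
        · subst hse
          exact hne (Prod.ext (add_right_cancel h) rfl)
        · have hlt := hdom s hs hs0 hse
          have hle := htop γ hγ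
          have hw : wt ν γ + wt ν s = wt ν γ₀ + wt ν e := by rw [← wt_add, ← wt_add, h]
          linarith
    · rfl
  · intro hn
    exact absurd (Finset.mem_product.mpr ⟨hγ₀, he⟩) hn

/-- Two top points of `F` on the axis `ℝ·e` coincide (the axis meets the top line once, as `⟨ν,e⟩ ≠ 0`). -/
theorem onAxis_unique (ν : Fin 2 → ℝ) (e γ₁ γ₂ : Fin 2 →₀ ℕ) (hwe : wt ν e ≠ 0)
    (hw : wt ν γ₁ = wt ν γ₂) (h1 : OnAxis γ₁ e) (h2 : OnAxis γ₂ e) : γ₁ = γ₂ := by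
  unfold OnAxis at h1 h2
  have h1r : ((γ₁ 0 : ℕ) : ℝ) * ((e 1 : ℕ) : ℝ) = ((γ₁ 1 : ℕ) : ℝ) * ((e 0 : ℕ) : ℝ) := by exact_mod_cast h1
  have h2r : ((γ₂ 0 : ℕ) : ℝ) * ((e 1 : ℕ) : ℝ) = ((γ₂ 1 : ℕ) : ℝ) * ((e 0 : ℕ) : ℝ) := by exact_mod_cast h2
  unfold wt at hw hwe
  -- γ_i · W = e_i · wt γ
  have k10 : ((γ₁ 0 : ℕ) : ℝ) * (ν 0 * ((e 0 : ℕ) : ℝ) + ν 1 * ((e 1 : ℕ) : ℝ)) =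
      ((e 0 : ℕ) : ℝ) * (ν 0 * ((γ₁ 0 : ℕ) : ℝ) + ν 1 * ((γ₁ 1 : ℕ) : ℝ)) := by linear_combination (ν 1) * h1r
  have k20 : ((γ₂ 0 : ℕ) : ℝ) * (ν 0 * ((e 0 : ℕ) : ℝ) + ν 1 * ((e 1 : ℕ) : ℝ)) =
      ((e 0 : ℕ) : ℝ) * (ν 0 * ((γ₂ 0 : ℕ) : ℝ) + ν 1 * ((γ₂ 1 : ℕ) : ℝ)) := by linear_combination (ν 1) * h2r
  have k11 : ((γ₁ 1 : ℕ) : ℝ) * (ν 0 * ((e 0 : ℕ) : ℝ) + ν 1 * ((e 1 : ℕ) : ℝ)) =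
      ((e 1 : ℕ) : ℝ) * (ν 0 * ((γ₁ 0 : ℕ) : ℝ) + ν 1 * ((γ₁ 1 : ℕ) : ℝ)) := by linear_combination (-(ν 0)) * h1r
  have k21 : ((γ₂ 1 : ℕ) : ℝ) * (ν 0 * ((e 0 : ℕ) : ℝ) + ν 1 * ((e 1 : ℕ) : ℝ)) =
      ((e 1 : ℕ) : ℝ) * (ν 0 * ((γ₂ 0 : ℕ) : ℝ) + ν 1 * ((γ₂ 1 : ℕ) : ℝ)) := by linear_combination (-(ν 0)) * h2r
  have e0 : ((γ₁ 0 : ℕ) : ℝ) = ((γ₂ 0 : ℕ) : ℝ) := by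
    apply mul_right_cancel₀ hwe
    rw [k10, k20, hw]
  have e1 : ((γ₁ 1 : ℕ) : ℝ) = ((γ₂ 1 : ℕ) : ℝ) := by
    apply mul_right_cancel₀ hwe
    rw [k11, k21, hw]
  ext i
  fin_cases i
  · exact_mod_cast e0
  · exact_mod_cast e1

/-- **LEMMA 2 in the kernel** (axial transfer). -/
theorem axialTransfer : AxialTransfer := by
  intro ν F w e hF hlead hedge
  have hlead' := hlead
  obtain ⟨he, he0, hwe, hdom⟩ := hlead'
  obtain ⟨p, hp, q, hq, hpq, hpmax, hwq⟩ := hedge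
  by_cases hax : ∃ γ₁ ∈ F.support, ∃ γ₂ ∈ F.support,
      γ₁ ≠ γ₂ ∧ wt ν γ₁ = wt ν p ∧ wt ν γ₂ = wt ν p ∧ ¬ OnAxis γ₁ e ∧ ¬ OnAxis γ₂ e
  · -- Case A: two top points off the axis ⇒ an edge of J(F,w) in direction ν
    right
    obtain ⟨γ₁, h1, γ₂, h2, hne, hw1, hw2, hna1, hna2⟩ := hax
    have top1 : ∀ r ∈ F.support, wt ν r ≤ wt ν γ₁ := fun r hr => hw1 ▸ hpmax r hr
    have top2 : ∀ r ∈ F.support, wt ν r ≤ wt ν γ₂ := fun r hr => hw2 ▸ hpmax r hr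
    have mem : ∀ γ ∈ F.support, (∀ r ∈ F.support, wt ν r ≤ wt ν γ) → ¬ OnAxis γ e →
        γ + e ∈ (jac F w).support := by
      intro γ hγ htop hna
      rw [MvPolynomial.mem_support_iff, coeff_jac_top ν F w e γ hlead hγ htop]
      refine mul_ne_zero (mul_ne_zero (MvPolynomial.mem_support_iff.mp hγ) (MvPolynomial.mem_support_iff.mp he)) ?_
      rw [Int.cast_ne_zero, Ne, ← onAxis_iff_idet]
      exact hna
    refine ⟨γ₁ + e, mem γ₁ h1 top1 hna1, γ₂ + e, mem γ₂ h2 top2 hna2, ?_, ?_, ?_⟩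
    · intro h; exact hne (add_right_cancel h)
    · intro r hr
      obtain ⟨γ, hγ, s, hs, rfl, hdet⟩ := exists_of_mem_support_jac F w r hr
      have hs0 : s ≠ 0 := by rintro rfl; exact hdet (idet_zero_right γ)
      have hws : wt ν s ≤ wt ν e := by
        by_cases hse : s = e
        · rw [hse]
        · exact le_of_lt (hdom s hs hs0 hse)
      rw [wt_add, wt_add]
      linarith [top1 γ hγ]
    · rw [wt_add, wt_add, hw1, hw2]
  · -- Case B: at most one top point off the axis ⇒ ν is e-special for F
    left
    push Not at hax
    have uniq : ∀ γ₁ γ₂ : Fin 2 →₀ ℕ, wt ν γ₁ = wt ν p → wt ν γ₂ = wt ν p → OnAxis γ₁ e → OnAxis γ₂ e → γ₁ = γ₂ :=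
      fun γ₁ γ₂ hw1 hw2 h1 h2 => onAxis_unique ν e γ₁ γ₂ hwe (hw1.trans hw2.symm) h1 h2
    refine ⟨p, hp, q, hq, hpq, hpmax, hwq, ?_, ?_⟩
    · intro r hr hwr
      by_contra hnot
      push Not at hnot
      obtain ⟨hrp, hrq⟩ := hnot
      by_cases hpa : OnAxis p e
      · have hqa : ¬ OnAxis q e := fun h => hpq (uniq p q rfl hwq hpa h)
        have hra : ¬ OnAxis r e := fun h => hrp (uniq r p hwr rfl h hpa)
        exact hra (hax q hq r hr (fun h => hrq h.symm) hwq hwr hqa)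
      · have hqa : OnAxis q e := hax p hp q hq hpq rfl hwq hpa
        have hra : OnAxis r e := hax p hp r hr (fun h => hrp h.symm) rfl hwr hpa
        exact hrq (uniq r q hwr hwq hra hqa)
    · by_contra hno
      push Not at hno
      exact hno.2 (hax p hp q hq hpq rfl hwq hno.1)


/-! ## Kernel: the dependent case `J(w₂,w₁) = 0` (memo §2 (i)), sorry-free
By the chain rule `J(D,w₁) = 0`; by the top-coefficient formula every top point of `D` at `ν` lies on the axis `ℝ·e`,
and two such points coincide — so `D` has no edge in any direction where `w₁` has an axial lead. -/

/-- ★ **The dependent case in the kernel** (`DependentCase`): if `J(w₂,w₁) = 0` then `P(w₁,w₂)` has no edge in any direction where `w₁` has an axial lead. [val-idea-35 g9] -/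
theorem dependentCase : DependentCase := by
  intro ν P w₁ w₂ e hJ hlead hedge
  have hcr : ∀ (P w₁ w₂ : Poly2),
      jac (MvPolynomial.aeval ![w₁, w₂] P) w₁ = MvPolynomial.aeval ![w₁, w₂] (pderiv 1 P) * jac w₂ w₁ := chainRule
  have hJD : jac (MvPolynomial.aeval ![w₁, w₂] P) w₁ = 0 := by rw [hcr P w₁ w₂, hJ, mul_zero]
  obtain ⟨p, hp, q, hq, hpq, hpmax, hwq⟩ := hedge
  have hwe : wt ν e ≠ 0 := hlead.2.2.1
  have onax : ∀ γ ∈ (MvPolynomial.aeval ![w₁, w₂] P).support, wt ν γ = wt ν p → OnAxis γ e := by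
    intro γ hγ hw
    have htop : ∀ r ∈ (MvPolynomial.aeval ![w₁, w₂] P).support, wt ν r ≤ wt ν γ :=
      fun r hr => hw ▸ hpmax r hr
    have hc := coeff_jac_top ν _ w₁ e γ hlead hγ htop
    rw [hJD, coeff_zero] at hc
    have hdet : ((idet γ e : ℤ) : ℂ) = 0 := by
      rcases mul_eq_zero.mp hc.symm with h | h
      · rcases mul_eq_zero.mp h with h | h
        · exact absurd h (MvPolynomial.mem_support_iff.mp hγ)
        · exact absurd h (MvPolynomial.mem_support_iff.mp hlead.1)
      · exact h
    rw [onAxis_iff_idet]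
    exact_mod_cast hdet
  exact hpq (onAxis_unique ν e p q hwe hwq.symm (onax p hp rfl) (onax q hq hwq))


end Summit.ValiantsHypothesis.ValiantsHypothesis.Theorems.TwoProducts.RankTwoJacobian

end
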